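import Literature.Topology.FourManifolds.CobordismAttachmentProofs
import Literature.Topology.FourManifolds.CollarGermExtension
import Literature.Topology.FourManifolds.CylinderSeeley
import HarnessLib

/-!
# Flattening a diffeomorphism near an end of a cobordism (uniqueness of collars)

Topic `Literature/Topology/FourManifolds` (infrastructure for the fact seat of
`Literature.Barriers.SmoothPoincare4.akbulutRuberman2016_boundaryDiffeosExtend`,
`Literature/Barriers/SmoothPoincare4/ExoticContractibleTheoremAProofs.lean`).  Everything here is
PROVED; no definitions, no named facts.

Let `X` be a cobordism from `M` to `N` (`Cobordism n M N`) and `G` a self-diffeomorphism of the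
total space `X.W` fixing the incoming end `inl M` POINTWISE.  The main theorem
`Cobordism.exists_diffeomorph_flatten_inl` produces a self-diffeomorphism `Ψ` of `X.W` fixing the
far end `inr N` pointwise and such that `Ψ ∘ G` is the IDENTITY ON A NEIGHBOURHOOD of `inl M`.
Consequently `Ψ ∘ G` is a self-diffeomorphism of `X.W` which agrees with `G` on `inr N` and is
the identity near `inl M` — the form in which a diffeomorphism of an attached cobordism
`W ∪_ψ X` extends by the identity over `W`.

This is the **uniqueness of collars** (Bröcker–Jänich, *Introduction to Differential Topology*
(1982), (13.7); Hirsch, *Differential Topology* (1976), Ch. 8 §1, Thm. 1.8 and the remark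
following Thm. 1.9; Munkres, *Elementary Differential Topology* (1966), §6) applied to the collar
`κ` of `inl M` read off an open collar of `∂X` (`Cobordism.endCollar`) and its image `G ∘ κ`:

* §1 the collar `κ = endCollar C` of the incoming end and its inverse
  `z ↦ (inlBInv (proj z), height z)` on the collar region over the incoming part;
* §2 the **collar germ** `Γ = κ⁻¹ ∘ G ∘ κ` of `G` along `M × {0}` (a `CollarGerm` in the sense of
  `CollarGerm.lean`, its two-sided height supplied by Seeley extension, `CylinderSeeley.lean`),
  and its extension `S` to the open half cylinder, `S = Γ` near the bottom, `S = id` above a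
  level (`CollarGerm.exists_extension`, `CollarGermExtension.lean`);
* §3 the diffeomorphism `Ψ = κ ∘ S⁻¹ ∘ κ⁻¹` on the collar region of positive height, the identity
  elsewhere: it is smooth because it equals `G⁻¹` near `inl M`, a conjugate of `S⁻¹` on the open
  collar region, and the identity off a compact piece of the collar; and `Ψ ∘ G = id` near
  `inl M`.

## References

* Th. Bröcker, K. Jänich, *Introduction to Differential Topology*, CUP (1982), (13.7).
  [BrockerJanich1982]
* M. W. Hirsch, *Differential Topology*, GTM 33 (1976), Ch. 8 §1, Thm. 1.8–1.9. [HirschDT1976]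
-/

open scoped Manifold ContDiff Topology
open Set Function

noncomputable section

namespace Literature.Topology.FourManifolds

universe u

namespace Cobordism

variable {n : ℕ} {M N : Type u} [TopologicalSpace M] [ChartedSpace (EuclideanSpace ℝ (Fin n)) M]
  [TopologicalSpace N] [ChartedSpace (EuclideanSpace ℝ (Fin n)) N] (X : Cobordism n M N)

/-! ### §0 The ends of a cobordism are compact Hausdorff -/

/-- The incoming end of a cobordism is compact (it is a closed subset of the compact total
space). [folklore] -/
theorem compactSpace_of_inl (X : Cobordism n M N) : CompactSpace M := by
  have h1 : IsCompact (range X.inl) := X.isClosed_range_inl.isCompact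
  have h2 : IsCompact (univ : Set M) := by
    rw [X.isSmoothEmbedding_inl.isEmbedding.isInducing.isCompact_iff, image_univ]
    exact h1
  exact isCompact_univ_iff.1 h2

/-- The outgoing end of a cobordism is compact. [folklore] -/
theorem compactSpace_of_inr (X : Cobordism n M N) : CompactSpace N :=
  X.symm.compactSpace_of_inl

/-- The incoming end of a cobordism is Hausdorff. [folklore] -/
theorem t2Space_of_inl (X : Cobordism n M N) : T2Space M :=
  X.isSmoothEmbedding_inl.isEmbedding.t2Space

/-- The outgoing end of a cobordism is Hausdorff. [folklore] -/
theorem t2Space_of_inr (X : Cobordism n M N) : T2Space N :=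
  X.isSmoothEmbedding_inr.isEmbedding.t2Space

/-! ### §1 The collar of the incoming end and its inverse -/

section Collar

variable (C : X.bdry.OpenCollar)

/-- The collar points of the incoming end of height in `[0, a)` are exactly the points of the
collar region over the incoming part of height `< a`. [folklore] -/
theorem endCollar_mem_regionOver_height (m : M) {t : ℝ} (ht : 0 ≤ t) :
    X.endCollar C m t ∈ C.regionOver X.inlPart ∧ C.height (X.endCollar C m t) = t :=
  ⟨X.endCollar_mem_regionOver C m ht, X.height_endCollar C m ht⟩

variable [Nonempty M]

/-- The inverse of the end collar on the collar region over the incoming part: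
`endCollar (inlBInv (proj z)) (height z) = z`. [folklore] -/
theorem endCollar_inlBInv_proj {z : X.W} (hz : z ∈ C.regionOver X.inlPart) :
    X.endCollar C (X.inlBInv (C.proj z)) (C.height z) = z := by
  change C.toFun (X.inlB (X.inlBInv (C.proj z))) (C.height z) = z
  rw [X.inlB_inlBInv hz.2, C.apply_proj_height z hz.1]

/-- The end collar followed by the inverse: `(inlBInv (proj (endCollar m t)), height (endCollar m t))
= (m, t)` for `t ≥ 0`. [folklore] -/
theorem inlBInv_proj_endCollar (m : M) {t : ℝ} (ht : 0 ≤ t) :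
    (X.inlBInv (C.proj (X.endCollar C m t)), C.height (X.endCollar C m t)) = (m, t) := by
  rw [X.proj_endCollar C m ht, X.height_endCollar C m ht, X.inlBInv_inlB]

/-- A point of the collar region over the incoming part is an end-collar point of nonnegative
height. [folklore] -/
theorem exists_endCollar_eq_of_mem_regionOver {z : X.W} (hz : z ∈ C.regionOver X.inlPart) :
    ∃ m t, 0 ≤ t ∧ X.endCollar C m t = z :=
  ⟨X.inlBInv (C.proj z), C.height z, C.height_nonneg z hz.1, X.endCollar_inlBInv_proj C hz⟩

/-- The inverse `z ↦ (inlBInv (proj z), height z)` is smooth on the collar region over the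
incoming part. [folklore] -/
theorem contMDiffOn_inlBInv_proj [IsManifold (𝓡 n) ∞ M] :
    ContMDiffOn (𝓡∂ (n + 1)) ((𝓡 n).prod 𝓘(ℝ, ℝ)) ∞
      (fun z => (X.inlBInv (C.proj z), C.height z)) (C.regionOver X.inlPart) :=
  (X.contMDiffOn_inlBInv.comp (C.contMDiffOn_proj.mono inter_subset_left) fun _ hz => hz.2).prodMk
    (C.contMDiffOn_height.mono inter_subset_left)

omit [Nonempty M] in
/-- The collar region over the incoming part of positive height is open. [folklore] -/
theorem isOpen_regionOver_inter_height_pos :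
    IsOpen {z | z ∈ C.regionOver X.inlPart ∧ 0 < C.height z} :=
  (C.continuousOn_height.mono inter_subset_left).isOpen_inter_preimage
    (C.isOpen_regionOver X.inlPart X.isOpen_inlPart) isOpen_Ioi

omit [Nonempty M] in
/-- The collar region over the incoming part of height `< a` is open. [folklore] -/
theorem isOpen_regionOver_inter_height_lt (a : ℝ) :
    IsOpen {z | z ∈ C.regionOver X.inlPart ∧ C.height z < a} :=
  (C.continuousOn_height.mono inter_subset_left).isOpen_inter_preimage
    (C.isOpen_regionOver X.inlPart X.isOpen_inlPart) isOpen_Iio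

omit [Nonempty M] in
/-- The far end misses the collar region of positive height over the incoming part (its points
are boundary points, of height `0`). [folklore] -/
theorem inr_not_mem_regionOver_inter_height_pos (y : N) :
    X.inr y ∉ {z | z ∈ C.regionOver X.inlPart ∧ 0 < C.height z} := by
  rintro ⟨hz, hpos⟩
  have h0 : C.height (X.inr y) = 0 := (C.height_eq_zero_iff hz.1).2 (X.inr_mem_boundary y)
  exact hpos.ne' h0

omit [Nonempty M] in
/-- The incoming end misses the collar region of positive height. [folklore] -/
theorem inl_not_mem_regionOver_inter_height_pos (m : M) :
    X.inl m ∉ {z | z ∈ C.regionOver X.inlPart ∧ 0 < C.height z} := by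
  rintro ⟨hz, hpos⟩
  have h0 : C.height (X.inl m) = 0 := (C.height_eq_zero_iff hz.1).2 (X.inl_mem_boundary m)
  exact hpos.ne' h0

omit [Nonempty M] in
/-- The compact pieces `endCollar '' (M × [0, a])` of the collar. [folklore] -/
theorem isCompact_image_endCollar [CompactSpace M] (a : ℝ) :
    IsCompact ((uncurry (X.endCollar C)) '' ((univ : Set M) ×ˢ Icc 0 a)) :=
  (isCompact_univ.prod isCompact_Icc).image_of_continuousOn
    ((X.continuousOn_endCollar C).mono (prod_mono Subset.rfl fun _ ht => ht.1))

omit [Nonempty M] in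
/-- **Trichotomy**: every point of `X.W` is a collar point over the incoming part of positive
height, or a point of `inl M`, or lies off the compact piece `endCollar '' (M × [0, a])`.
[folklore] -/
theorem mem_regionOver_pos_or (a : ℝ) (z : X.W) :
    z ∈ {z | z ∈ C.regionOver X.inlPart ∧ 0 < C.height z} ∨ z ∈ range X.inl ∨
      z ∉ (uncurry (X.endCollar C)) '' ((univ : Set M) ×ˢ Icc 0 a) := by
  by_cases h : z ∈ (uncurry (X.endCollar C)) '' ((univ : Set M) ×ˢ Icc 0 a)
  · obtain ⟨⟨m, t⟩, ⟨-, ht⟩, rfl⟩ := h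
    have ht0 : (0 : ℝ) ≤ t := ht.1
    rcases ht0.eq_or_lt with h0 | hpos
    · right; left
      refine ⟨m, ?_⟩
      change X.inl m = X.endCollar C m t
      rw [← h0, X.endCollar_zero]
    · left
      refine ⟨X.endCollar_mem_regionOver C m ht0, ?_⟩
      change 0 < C.height (X.endCollar C m t)
      rwa [X.height_endCollar C m ht0]
  · exact Or.inr (Or.inr h)

end Collar

/-! ### §2 The collar germ of `G` along the incoming end and its extension -/

section Germ

variable (C : X.bdry.OpenCollar) [Nonempty M] [IsManifold (𝓡 n) ∞ M] [CompactSpace M]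
  (G : X.W ≃ₘ⟮𝓡∂ (n + 1), 𝓡∂ (n + 1)⟯ X.W) (hG : ∀ m, G (X.inl m) = X.inl m)

include hG in
omit [Nonempty M] [IsManifold (𝓡 n) ∞ M] [CompactSpace M] in
/-- A diffeomorphism fixing `inl M` pointwise has an inverse fixing `inl M` pointwise. [folklore] -/
theorem symm_apply_inl (m : M) : G.symm (X.inl m) = X.inl m := by
  have h := congrArg G.symm (hG m)
  rw [G.symm_apply_apply] at h
  exact h.symm

include hG in
omit [Nonempty M] [IsManifold (𝓡 n) ∞ M] in
/-- **A slab of the collar carried into the collar region.** There is `δ₁ > 0` such that `G`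
and `G⁻¹` carry every collar point of the incoming end of height `< δ₁` into the collar region
over the incoming part (compactness of `M`, continuity, `G = id` on `inl M`). [folklore] -/
theorem exists_slab_regionOver :
    ∃ δ₁, 0 < δ₁ ∧ ∀ m, ∀ t ∈ Ico 0 δ₁,
      G (X.endCollar C m t) ∈ C.regionOver X.inlPart ∧
        G.symm (X.endCollar C m t) ∈ C.regionOver X.inlPart := by
  have h1 : ContinuousOn (uncurry (X.endCollar C)) ((univ : Set M) ×ˢ Ico 0 1) :=
    (X.continuousOn_endCollar C).mono (prod_mono Subset.rfl fun _ ht => ht.1)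
  have hg : ContinuousOn
      (fun q : M × ℝ => (G (uncurry (X.endCollar C) q), G.symm (uncurry (X.endCollar C) q)))
      ((univ : Set M) ×ˢ Ico 0 1) :=
    (G.continuous.comp_continuousOn h1).prodMk (G.symm.continuous.comp_continuousOn h1)
  have hV : IsOpen ((C.regionOver X.inlPart) ×ˢ (C.regionOver X.inlPart)) :=
    (C.isOpen_regionOver _ X.isOpen_inlPart).prod (C.isOpen_regionOver _ X.isOpen_inlPart)
  have h0 : ∀ m : M, (G (uncurry (X.endCollar C) (m, 0)), G.symm (uncurry (X.endCollar C) (m, 0)))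
      ∈ (C.regionOver X.inlPart) ×ˢ (C.regionOver X.inlPart) := by
    intro m
    have hm : X.inl m ∈ C.regionOver X.inlPart :=
      C.incl_mem_regionOver X.inlPart (X.inlB_mem_inlPart m)
    change (G (X.endCollar C m 0), G.symm (X.endCollar C m 0)) ∈ _
    rw [X.endCollar_zero, hG m, X.symm_apply_inl G hG m]
    exact ⟨hm, hm⟩
  obtain ⟨u, hu, -, hmem⟩ := exists_forall_mem_of_continuousOn one_pos hg hV h0
  exact ⟨u, hu, fun m t ht => hmem m t ht⟩

include hG in
/-- **The collar germ of `G` and its extension to the open half cylinder.**  With the collar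
`κ = endCollar C` of the incoming end and its inverse `κ⁻¹ z = (inlBInv (proj z), height z)`, the
germ `Γ = κ⁻¹ ∘ G ∘ κ` along `M × {0}` is a collar germ (`CollarGerm`: it is smooth on a slab
`M × [0, δ)` together with the inverse germ `κ⁻¹ ∘ G⁻¹ ∘ κ`, fixes `M × {0}` pointwise because
`G` fixes `inl M`, and its height admits a two-sided smooth extension by Seeley's theorem,
`exists_contMDiff_eq_on_slab`), so by the uniqueness of collars in germ form
(`CollarGerm.exists_extension`) there is a bijection `S` of `M × (0, ∞)`, smooth with smooth
inverse `S⁻¹`, with `S = Γ` on `M × (0, a₂]` and `S = id` on `M × [a₁, ∞)`,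
`0 < a₂ < a₁ < δ`. Bröcker–Jänich (1982), (13.7); Hirsch (1976), Ch. 8 §1, Thm. 1.8.
[cite: BrockerJanich1982, (13.7)] -/
theorem exists_germ_extension :
    ∃ (Smap Sinv : M × ℝ → M × ℝ) (a₁ a₂ δ : ℝ), 0 < a₂ ∧ a₂ < a₁ ∧ a₁ < δ ∧
      ContMDiffOn ((𝓡 n).prod 𝓘(ℝ, ℝ)) ((𝓡 n).prod 𝓘(ℝ, ℝ)) ∞ Smap (univ ×ˢ Ioi 0) ∧
      ContMDiffOn ((𝓡 n).prod 𝓘(ℝ, ℝ)) ((𝓡 n).prod 𝓘(ℝ, ℝ)) ∞ Sinv (univ ×ˢ Ioi 0) ∧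
      MapsTo Smap (univ ×ˢ Ioi (0 : ℝ)) (univ ×ˢ Ioi (0 : ℝ)) ∧
      MapsTo Sinv (univ ×ˢ Ioi (0 : ℝ)) (univ ×ˢ Ioi (0 : ℝ)) ∧
      (∀ q ∈ (univ : Set M) ×ˢ Ioi (0 : ℝ), Sinv (Smap q) = q) ∧
      (∀ q ∈ (univ : Set M) ×ˢ Ioi (0 : ℝ), Smap (Sinv q) = q) ∧
      (∀ m, ∀ t ∈ Ioc 0 a₂, Smap (m, t) =
        (X.inlBInv (C.proj (G (X.endCollar C m t))), C.height (G (X.endCollar C m t)))) ∧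
      (∀ q ∈ (univ : Set M) ×ˢ Ici a₁, Smap q = q) ∧
      (∀ m, ∀ t ∈ Ico 0 δ, G (X.endCollar C m t) ∈ C.regionOver X.inlPart ∧
        G.symm (X.endCollar C m t) ∈ C.regionOver X.inlPart) := by
  obtain ⟨δ₁, hδ₁, hslab⟩ := X.exists_slab_regionOver C G hG
  -- the germ and the inverse germ
  set Γ : M × ℝ → M × ℝ := fun q =>
    (X.inlBInv (C.proj (G (uncurry (X.endCollar C) q))), C.height (G (uncurry (X.endCollar C) q)))
    with hΓ
  set Ψ : M × ℝ → M × ℝ := fun q =>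
    (X.inlBInv (C.proj (G.symm (uncurry (X.endCollar C) q))),
      C.height (G.symm (uncurry (X.endCollar C) q))) with hΨ
  -- smoothness on the slab of width `δ₁`
  have hι : ContMDiffOn ((𝓡 n).prod 𝓘(ℝ, ℝ)) (𝓡∂ (n + 1)) ∞ (uncurry (X.endCollar C))
      ((univ : Set M) ×ˢ Ico 0 δ₁) :=
    (X.contMDiffOn_endCollar C).mono (prod_mono Subset.rfl fun _ ht => ht.1)
  have hΓs : ContMDiffOn ((𝓡 n).prod 𝓘(ℝ, ℝ)) ((𝓡 n).prod 𝓘(ℝ, ℝ)) ∞ Γ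
      ((univ : Set M) ×ˢ Ico 0 δ₁) := by
    refine (X.contMDiffOn_inlBInv_proj C).comp (G.contMDiff.comp_contMDiffOn hι) ?_
    rintro ⟨m, t⟩ ⟨-, ht⟩
    exact (hslab m t ht).1
  have hΨs : ContMDiffOn ((𝓡 n).prod 𝓘(ℝ, ℝ)) ((𝓡 n).prod 𝓘(ℝ, ℝ)) ∞ Ψ
      ((univ : Set M) ×ˢ Ico 0 δ₁) := by
    refine (X.contMDiffOn_inlBInv_proj C).comp (G.symm.contMDiff.comp_contMDiffOn hι) ?_
    rintro ⟨m, t⟩ ⟨-, ht⟩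
    exact (hslab m t ht).2
  -- two-sided extension of the height (Seeley)
  have hgs : ContMDiffOn ((𝓡 n).prod 𝓘(ℝ, ℝ)) 𝓘(ℝ, ℝ) ∞ (fun q => (Γ q).2)
      ((univ : Set M) ×ˢ Ico 0 δ₁) :=
    contMDiff_snd.comp_contMDiffOn hΓs
  obtain ⟨H, hH, hHeq⟩ := exists_contMDiff_eq_on_slab (I := 𝓡 n) hδ₁ hgs
  -- values at the bottom
  have hΓ0 : ∀ m, Γ (m, 0) = (m, 0) := by
    intro m
    change (X.inlBInv (C.proj (G (X.endCollar C m 0))), C.height (G (X.endCollar C m 0))) = (m, 0)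
    rw [X.endCollar_zero, hG m, ← X.endCollar_zero C m]
    exact X.inlBInv_proj_endCollar C m le_rfl
  have hΨ0 : ∀ m, Ψ (m, 0) = (m, 0) := by
    intro m
    change (X.inlBInv (C.proj (G.symm (X.endCollar C m 0))),
      C.height (G.symm (X.endCollar C m 0))) = (m, 0)
    rw [X.endCollar_zero, X.symm_apply_inl G hG m, ← X.endCollar_zero C m]
    exact X.inlBInv_proj_endCollar C m le_rfl
  -- the inverse relations
  have hΨΓ : ∀ m, ∀ t ∈ Ico 0 δ₁, Ψ (Γ (m, t)) = (m, t) := by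
    intro m t ht
    have hz := (hslab m t ht).1
    change (X.inlBInv (C.proj (G.symm (X.endCollar C (X.inlBInv (C.proj (G (X.endCollar C m t))))
      (C.height (G (X.endCollar C m t)))))), C.height (G.symm (X.endCollar C
        (X.inlBInv (C.proj (G (X.endCollar C m t)))) (C.height (G (X.endCollar C m t)))))) = (m, t)
    rw [X.endCollar_inlBInv_proj C hz, G.symm_apply_apply]
    exact X.inlBInv_proj_endCollar C m ht.1
  have hΓΨ : ∀ m, ∀ t ∈ Ico 0 δ₁, Γ (Ψ (m, t)) = (m, t) := by
    intro m t ht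
    have hz := (hslab m t ht).2
    change (X.inlBInv (C.proj (G (X.endCollar C (X.inlBInv (C.proj (G.symm (X.endCollar C m t))))
      (C.height (G.symm (X.endCollar C m t)))))), C.height (G (X.endCollar C
        (X.inlBInv (C.proj (G.symm (X.endCollar C m t)))) (C.height (G.symm (X.endCollar C m t))))))
      = (m, t)
    rw [X.endCollar_inlBInv_proj C hz, G.apply_symm_apply]
    exact X.inlBInv_proj_endCollar C m ht.1
  -- the collar germ
  have hδ2 : 0 < δ₁ / 2 := half_pos hδ₁
  have hsub : (univ : Set M) ×ˢ Ico 0 (δ₁ / 2) ⊆ (univ : Set M) ×ˢ Ico 0 δ₁ :=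
    prod_mono Subset.rfl (Ico_subset_Ico_right (half_le_self hδ₁.le))
  let Cg : CollarGerm n M :=
    { Γ := Γ
      Ψ := Ψ
      height := H
      δ := δ₁ / 2
      δ_pos := hδ2
      contMDiffOn_Γ := hΓs.mono hsub
      contMDiffOn_Ψ := hΨs.mono hsub
      contMDiff_height := hH
      Γ_zero := hΓ0
      Ψ_zero := hΨ0
      Γ_snd_nonneg := fun m t ht =>
        C.height_nonneg _ (hslab m t ⟨ht.1, ht.2.trans_le (half_le_self hδ₁.le)⟩).1.1
      Ψ_snd_nonneg := fun m t ht =>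
        C.height_nonneg _ (hslab m t ⟨ht.1, ht.2.trans_le (half_le_self hδ₁.le)⟩).2.1
      Ψ_Γ := fun m t ht _ => hΨΓ m t ⟨ht.1, ht.2.trans_le (half_le_self hδ₁.le)⟩
      Γ_Ψ := fun m t ht _ => hΓΨ m t ⟨ht.1, ht.2.trans_le (half_le_self hδ₁.le)⟩
      height_eq := fun m t ht => hHeq m t ht }
  obtain ⟨Smap, Sinv, a₁, a₂, ha₂, ha₂₁, ha₁δ, hS, hSi, hmS, hmSi, hl, hr, hbot, htop⟩ :=
    Cg.exists_extension
  refine ⟨Smap, Sinv, a₁, a₂, δ₁ / 2, ha₂, ha₂₁, ha₁δ, hS, hSi, hmS, hmSi, hl, hr,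
    fun m t ht => ?_, htop, fun m t ht => hslab m t ⟨ht.1, ht.2.trans_le (half_le_self hδ₁.le)⟩⟩
  exact (hbot (m, t) ⟨mem_univ _, ht⟩).1

end Germ

/-! ### §3 The flattening diffeomorphism -/

section Conj

variable (C : X.bdry.OpenCollar) [Nonempty M]

/-- **The conjugate `κ ∘ S ∘ κ⁻¹` is smooth on the collar region of positive height** over the
incoming part, for `S` smooth on the open half cylinder and preserving it. [folklore] -/
theorem contMDiffOn_endCollar_conj [IsManifold (𝓡 n) ∞ M] {S : M × ℝ → M × ℝ}
    (hS : ContMDiffOn ((𝓡 n).prod 𝓘(ℝ, ℝ)) ((𝓡 n).prod 𝓘(ℝ, ℝ)) ∞ S (univ ×ˢ Ioi 0))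
    (hmS : MapsTo S (univ ×ˢ Ioi (0 : ℝ)) (univ ×ˢ Ioi (0 : ℝ))) :
    ContMDiffOn (𝓡∂ (n + 1)) (𝓡∂ (n + 1)) ∞
      (fun z => uncurry (X.endCollar C) (S (X.inlBInv (C.proj z), C.height z)))
      {z | z ∈ C.regionOver X.inlPart ∧ 0 < C.height z} := by
  have h1 : ContMDiffOn (𝓡∂ (n + 1)) ((𝓡 n).prod 𝓘(ℝ, ℝ)) ∞
      (fun z => (X.inlBInv (C.proj z), C.height z))
      {z | z ∈ C.regionOver X.inlPart ∧ 0 < C.height z} :=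
    (X.contMDiffOn_inlBInv_proj C).mono fun z hz => hz.1
  have h2 : ContMDiffOn (𝓡∂ (n + 1)) ((𝓡 n).prod 𝓘(ℝ, ℝ)) ∞
      (fun z => S (X.inlBInv (C.proj z), C.height z))
      {z | z ∈ C.regionOver X.inlPart ∧ 0 < C.height z} :=
    hS.comp h1 fun z hz => ⟨mem_univ _, hz.2⟩
  refine (X.contMDiffOn_endCollar C).comp h2 fun z hz => ?_
  have hq : (X.inlBInv (C.proj z), C.height z) ∈ (univ : Set M) ×ˢ Ioi (0 : ℝ) :=
    ⟨mem_univ _, hz.2⟩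
  exact ⟨mem_univ _, Set.mem_Ici.2 (le_of_lt (Set.mem_Ioi.1 (hmS hq).2))⟩

/-- The conjugate `κ ∘ S ∘ κ⁻¹` carries the collar region of positive height over the incoming
part into itself. [folklore] -/
theorem endCollar_conj_mem {S : M × ℝ → M × ℝ}
    (hmS : MapsTo S (univ ×ˢ Ioi (0 : ℝ)) (univ ×ˢ Ioi (0 : ℝ))) {z : X.W}
    (hz : z ∈ {z | z ∈ C.regionOver X.inlPart ∧ 0 < C.height z}) :
    uncurry (X.endCollar C) (S (X.inlBInv (C.proj z), C.height z)) ∈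
      {z | z ∈ C.regionOver X.inlPart ∧ 0 < C.height z} := by
  have hq : (X.inlBInv (C.proj z), C.height z) ∈ (univ : Set M) ×ˢ Ioi (0 : ℝ) :=
    ⟨mem_univ _, hz.2⟩
  have ht : 0 < (S (X.inlBInv (C.proj z), C.height z)).2 := Set.mem_Ioi.1 (hmS hq).2
  refine ⟨X.endCollar_mem_regionOver C _ ht.le, ?_⟩
  change 0 < C.height (X.endCollar C _ _)
  rw [X.height_endCollar C _ ht.le]
  exact ht

/-- The conjugates of `S` and of a left inverse `T` of `S` compose to the identity on the
collar region of positive height. [folklore] -/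
theorem endCollar_conj_conj {S T : M × ℝ → M × ℝ}
    (hmS : MapsTo S (univ ×ˢ Ioi (0 : ℝ)) (univ ×ˢ Ioi (0 : ℝ)))
    (hTS : ∀ q ∈ (univ : Set M) ×ˢ Ioi (0 : ℝ), T (S q) = q) {z : X.W}
    (hz : z ∈ {z | z ∈ C.regionOver X.inlPart ∧ 0 < C.height z}) :
    uncurry (X.endCollar C) (T
      (X.inlBInv (C.proj (uncurry (X.endCollar C) (S (X.inlBInv (C.proj z), C.height z)))),
        C.height (uncurry (X.endCollar C) (S (X.inlBInv (C.proj z), C.height z))))) = z := by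
  have hq0 : (X.inlBInv (C.proj z), C.height z) ∈ (univ : Set M) ×ˢ Ioi (0 : ℝ) :=
    ⟨mem_univ _, hz.2⟩
  set q := S (X.inlBInv (C.proj z), C.height z) with hq
  have ht : 0 < q.2 := Set.mem_Ioi.1 (hmS hq0).2
  have h1 : (X.inlBInv (C.proj (uncurry (X.endCollar C) q)), C.height (uncurry (X.endCollar C) q))
      = q := X.inlBInv_proj_endCollar C q.1 ht.le
  rw [h1, hq, hTS (X.inlBInv (C.proj z), C.height z) hq0]
  exact X.endCollar_inlBInv_proj C hz.1

/-- Off the compact piece `κ (M × [0, a₁])`, the conjugate of an `S` which is the identity above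
the level `a₁` is the identity. [folklore] -/
theorem endCollar_conj_eq_self {S : M × ℝ → M × ℝ} {a₁ : ℝ}
    (hfix : ∀ q ∈ (univ : Set M) ×ˢ Ici a₁, S q = q) {z : X.W}
    (hz : z ∈ {z | z ∈ C.regionOver X.inlPart ∧ 0 < C.height z})
    (hza : z ∉ (uncurry (X.endCollar C)) '' ((univ : Set M) ×ˢ Icc 0 a₁)) :
    uncurry (X.endCollar C) (S (X.inlBInv (C.proj z), C.height z)) = z := by
  have ha : a₁ ≤ C.height z := by
    by_contra h
    refine hza ⟨(X.inlBInv (C.proj z), C.height z), ⟨mem_univ _, (C.height_nonneg z hz.1.1),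
      le_of_lt (not_le.1 h)⟩, ?_⟩
    exact X.endCollar_inlBInv_proj C hz.1
  have hq : (X.inlBInv (C.proj z), C.height z) ∈ (univ : Set M) ×ˢ Ici a₁ :=
    ⟨mem_univ _, ha⟩
  rw [hfix (X.inlBInv (C.proj z), C.height z) hq]
  exact X.endCollar_inlBInv_proj C hz.1

end Conj

/-- **Flattening a diffeomorphism near the incoming end.**  Let `X` be a cobordism from `M` to
`N` and `G` a self-diffeomorphism of `X.W` fixing `inl M` pointwise.  Then there is a
self-diffeomorphism `Ψ` of `X.W` fixing `inr N` pointwise such that `Ψ ∘ G` is the identity on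
an open neighbourhood `V` of `inl M`.  Proof: §2 gives the collar germ `Γ = κ⁻¹ G κ` of `G`
along the incoming end and its extension `S` (`S = Γ` near the bottom, `S = id` above the level
`a₁`); `Ψ` is `κ ∘ S⁻¹ ∘ κ⁻¹` on the collar region of positive height over the incoming part and
the identity elsewhere.  It equals `G⁻¹` on the `G`-image of the collar points of height
`< a₂` (an open neighbourhood of `inl M`), a conjugate of the smooth `S⁻¹` on the open collar
region, and the identity off the compact `κ (M × [0, a₁])`; these three open sets cover `X.W`,
so `Ψ` and likewise `Ψ⁻¹ = κ ∘ S ∘ κ⁻¹` are smooth.  This is the uniqueness of collars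
(Bröcker–Jänich (1982), (13.7); Hirsch (1976), Ch. 8 §1, Thm. 1.8) in the ambient, relative
form "a diffeomorphism which is the identity on a boundary component is isotopic, relative to
the rest of the boundary, to one which is the identity near it".
[cite: BrockerJanich1982, (13.7)] [cite: HirschDT1976, Ch. 8 §1, Thm. 1.8] -/
theorem exists_diffeomorph_flatten_inl [IsManifold (𝓡 n) ∞ M]
    (G : X.W ≃ₘ⟮𝓡∂ (n + 1), 𝓡∂ (n + 1)⟯ X.W) (hG : ∀ m, G (X.inl m) = X.inl m) :
    ∃ Ψ : X.W ≃ₘ⟮𝓡∂ (n + 1), 𝓡∂ (n + 1)⟯ X.W, (∀ y, Ψ (X.inr y) = X.inr y) ∧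
      ∃ V : Set X.W, IsOpen V ∧ range X.inl ⊆ V ∧ ∀ z ∈ V, Ψ (G z) = z := by
  classical
  rcases isEmpty_or_nonempty M with hM | hM
  · refine ⟨Diffeomorph.refl _ X.W ∞, fun y => rfl, ∅, isOpen_empty, ?_, fun z hz => hz.elim⟩
    rw [range_eq_empty]
  haveI : CompactSpace M := X.compactSpace_of_inl
  haveI : Nonempty X.bdry.carrier := ⟨X.inlB (Classical.arbitrary M)⟩
  obtain ⟨C⟩ := X.bdry.nonempty_openCollar
  obtain ⟨Smap, Sinv, a₁, a₂, δ, ha₂, ha₂₁, ha₁δ, hS, hSi, hmS, hmSi, hl, hr, hbot, htop, hslab⟩ :=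
    X.exists_germ_extension C G hG
  have ha₁ : 0 < a₁ := ha₂.trans ha₂₁
  -- `S⁻¹ = id` above the level `a₁` as well
  have htop' : ∀ q ∈ (univ : Set M) ×ˢ Ici a₁, Sinv q = q := by
    intro q hq
    have hq' : q ∈ (univ : Set M) ×ˢ Ioi (0 : ℝ) := ⟨mem_univ _, ha₁.trans_le hq.2⟩
    conv_lhs => rw [← htop q hq]
    exact hl q hq'
  -- the two maps
  set U : Set X.W := {z | z ∈ C.regionOver X.inlPart ∧ 0 < C.height z} with hU
  have hUo : IsOpen U := X.isOpen_regionOver_inter_height_pos C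
  set Ψf : X.W → X.W := fun z =>
    if z ∈ U then uncurry (X.endCollar C) (Sinv (X.inlBInv (C.proj z), C.height z)) else z
    with hΨf
  set Ψi : X.W → X.W := fun z =>
    if z ∈ U then uncurry (X.endCollar C) (Smap (X.inlBInv (C.proj z), C.height z)) else z
    with hΨi
  have Ψf_pos : ∀ z ∈ U,
      Ψf z = uncurry (X.endCollar C) (Sinv (X.inlBInv (C.proj z), C.height z)) :=
    fun z hz => by rw [hΨf]; exact if_pos hz
  have Ψf_neg : ∀ z ∉ U, Ψf z = z := fun z hz => by rw [hΨf]; exact if_neg hz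
  have Ψi_pos : ∀ z ∈ U,
      Ψi z = uncurry (X.endCollar C) (Smap (X.inlBInv (C.proj z), C.height z)) :=
    fun z hz => by rw [hΨi]; exact if_pos hz
  have Ψi_neg : ∀ z ∉ U, Ψi z = z := fun z hz => by rw [hΨi]; exact if_neg hz
  -- mutual inverses
  have hfi : ∀ z, Ψi (Ψf z) = z := by
    intro z
    by_cases hz : z ∈ U
    · rw [Ψf_pos z hz, Ψi_pos _ (X.endCollar_conj_mem C hmSi hz)]
      exact X.endCollar_conj_conj C hmSi hr hz
    · rw [Ψf_neg z hz, Ψi_neg z hz]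
  have hif : ∀ z, Ψf (Ψi z) = z := by
    intro z
    by_cases hz : z ∈ U
    · rw [Ψi_pos z hz, Ψf_pos _ (X.endCollar_conj_mem C hmS hz)]
      exact X.endCollar_conj_conj C hmS hl hz
    · rw [Ψi_neg z hz, Ψf_neg z hz]
  -- the neighbourhood `V` of `inl M` and the behaviour of the two maps on it
  set V : Set X.W := {z | z ∈ C.regionOver X.inlPart ∧ C.height z < a₂} with hV
  have hVo : IsOpen V := X.isOpen_regionOver_inter_height_lt C a₂
  have hVinl : range X.inl ⊆ V := by
    rintro _ ⟨m, rfl⟩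
    refine ⟨C.incl_mem_regionOver X.inlPart (X.inlB_mem_inlPart m), ?_⟩
    rw [← X.endCollar_zero C m, X.height_endCollar C m le_rfl]
    exact ha₂
  have hVf : ∀ z ∈ V, Ψf (G z) = z := by
    intro z hz
    obtain ⟨m, t, ht0, rfl⟩ := X.exists_endCollar_eq_of_mem_regionOver C hz.1
    have hta : t < a₂ := by
      have h := hz.2
      rwa [X.height_endCollar C m ht0] at h
    rcases ht0.eq_or_lt with rfl | htpos
    · rw [X.endCollar_zero, hG m, Ψf_neg _ (X.inl_not_mem_regionOver_inter_height_pos C m)]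
    · have hreg := (hslab m t ⟨ht0, hta.trans (ha₂₁.trans ha₁δ)⟩).1
      have hb := hbot m t ⟨htpos, hta.le⟩
      have hmt : ((m, t) : M × ℝ) ∈ (univ : Set M) ×ˢ Ioi (0 : ℝ) := ⟨mem_univ _, htpos⟩
      have hpos : 0 < C.height (G (X.endCollar C m t)) := by
        have h := Set.mem_Ioi.1 (hmS hmt).2
        rwa [hb] at h
      rw [Ψf_pos _ ⟨hreg, hpos⟩, ← hb, hl (m, t) hmt]
      rfl
  have hVi : ∀ z ∈ V, Ψi z = G z := by
    intro z hz
    obtain ⟨m, t, ht0, rfl⟩ := X.exists_endCollar_eq_of_mem_regionOver C hz.1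
    have hta : t < a₂ := by
      have h := hz.2
      rwa [X.height_endCollar C m ht0] at h
    rcases ht0.eq_or_lt with rfl | htpos
    · rw [X.endCollar_zero, hG m, Ψi_neg _ (X.inl_not_mem_regionOver_inter_height_pos C m)]
    · have hreg := (hslab m t ⟨ht0, hta.trans (ha₂₁.trans ha₁δ)⟩).1
      have hzU : X.endCollar C m t ∈ U :=
        ⟨X.endCollar_mem_regionOver C m ht0, by rwa [X.height_endCollar C m ht0]⟩
      rw [Ψi_pos _ hzU, X.inlBInv_proj_endCollar C m ht0, hbot m t ⟨htpos, hta.le⟩]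
      exact X.endCollar_inlBInv_proj C hreg
  -- smoothness of `Ψf`
  have hBo : IsOpen ((uncurry (X.endCollar C)) '' ((univ : Set M) ×ˢ Icc 0 a₁))ᶜ :=
    (X.isCompact_image_endCollar C a₁).isClosed.isOpen_compl
  have hcf : ContMDiff (𝓡∂ (n + 1)) (𝓡∂ (n + 1)) ∞ Ψf := by
    intro z
    rcases X.mem_regionOver_pos_or C a₁ z with hz | ⟨m, rfl⟩ | hz
    · have heq : Ψf =ᶠ[𝓝 z]
          fun z => uncurry (X.endCollar C) (Sinv (X.inlBInv (C.proj z), C.height z)) := by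
        filter_upwards [hUo.mem_nhds hz] with w hw
        exact Ψf_pos w hw
      exact ((X.contMDiffOn_endCollar_conj C hSi hmSi).contMDiffAt
        (hUo.mem_nhds hz)).congr_of_eventuallyEq heq
    · have hAo : IsOpen (G.symm ⁻¹' V) := hVo.preimage G.symm.continuous
      have hmA : X.inl m ∈ G.symm ⁻¹' V := by
        change G.symm (X.inl m) ∈ V
        rw [X.symm_apply_inl G hG m]
        exact hVinl (mem_range_self m)
      have heq : Ψf =ᶠ[𝓝 (X.inl m)] G.symm := by
        filter_upwards [hAo.mem_nhds hmA] with w hw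
        have h := hVf (G.symm w) hw
        rwa [G.apply_symm_apply] at h
      exact (G.symm.contMDiff _).congr_of_eventuallyEq heq
    · have heq : Ψf =ᶠ[𝓝 z] id := by
        filter_upwards [hBo.mem_nhds hz] with w hw
        by_cases hwU : w ∈ U
        · rw [Ψf_pos w hwU]
          exact X.endCollar_conj_eq_self C htop' hwU hw
        · exact Ψf_neg w hwU
      exact contMDiffAt_id.congr_of_eventuallyEq heq
  -- smoothness of `Ψi`
  have hci : ContMDiff (𝓡∂ (n + 1)) (𝓡∂ (n + 1)) ∞ Ψi := by
    intro z
    rcases X.mem_regionOver_pos_or C a₁ z with hz | ⟨m, rfl⟩ | hz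
    · have heq : Ψi =ᶠ[𝓝 z]
          fun z => uncurry (X.endCollar C) (Smap (X.inlBInv (C.proj z), C.height z)) := by
        filter_upwards [hUo.mem_nhds hz] with w hw
        exact Ψi_pos w hw
      exact ((X.contMDiffOn_endCollar_conj C hS hmS).contMDiffAt
        (hUo.mem_nhds hz)).congr_of_eventuallyEq heq
    · have heq : Ψi =ᶠ[𝓝 (X.inl m)] G := by
        filter_upwards [hVo.mem_nhds (hVinl (mem_range_self m))] with w hw
        exact hVi w hw
      exact (G.contMDiff _).congr_of_eventuallyEq heq
    · have heq : Ψi =ᶠ[𝓝 z] id := by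
        filter_upwards [hBo.mem_nhds hz] with w hw
        by_cases hwU : w ∈ U
        · rw [Ψi_pos w hwU]
          exact X.endCollar_conj_eq_self C htop hwU hw
        · exact Ψi_neg w hwU
      exact contMDiffAt_id.congr_of_eventuallyEq heq
  -- assemble
  refine ⟨{ toFun := Ψf
            invFun := Ψi
            left_inv := hfi
            right_inv := hif
            contMDiff_toFun := hcf
            contMDiff_invFun := hci }, fun y => ?_, V, hVo, hVinl, fun z hz => hVf z hz⟩
  exact Ψf_neg _ (X.inr_not_mem_regionOver_inter_height_pos C y)

end Cobordism

end Literature.Topology.FourManifolds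

end
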